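import Mathlib.Tactic.Ring
import Mathlib.Tactic.Linarith
import Mathlib.Tactic.Positivity
import Mathlib.Tactic.LinearCombination
import Mathlib.Data.Real.Basic
import Summits.HodgeConjecture.HodgeConjecture.Theorems.WeilClassTestFormatFourTwoSplit
import Summits.HodgeConjecture.HodgeConjecture.Theorems.WeilClassTestFormatFourTwoWalls
import HarnessLib

/-!
# Conjecture N in format (4,2) — part 3/4: the degenerate locus `K = 0` and the sorted main theorem

Prover 2, generation 13. `K = 0` forces the charge multiset `{v₁, v₂, r, −r}` on E; the sub-cases give `G₀ = 0` (`G0_nonneg_K0_double`,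
`G0_nonneg_K0_main`) or contradict centring + P4 (`K0_impossible_a/b`). `conjectureN_42_sorted`: for sorted E-charges `u₁ ≤ u₂ ≤ u₃ ≤ u₄` and
`v₁ ≤ v₂`, centring + purity + pairwise ampleness ⇒ `G₀ ≥ 0`: either an F-root sees all E-charges on one side (part 1), or `u₁ < v₁`, `v₂ < u₄` and
then `K > 0` is impossible (part 2), `K = 0` is the degenerate locus, and `K < 0` is the pattern `E F E E F E` (part 1) or a no-between pattern (part 2,
impossible). Part 4 removes the sorting. Pure algebra; nothing here is a case of HC, a rung or a door edge (C22). New cell result ⇒ Summits/.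
-/

set_option linter.dupNamespace false

namespace Summit.HodgeConjecture.HodgeConjecture.WeilClassTestFormatFourTwo

open Summit.HodgeConjecture.HodgeConjecture.WeilClassTestProductFormula
/-- Charge bookkeeping: three numbers with `a + b + c = p` and `a³ + b³ + c³ = p³` have a pair summing to zero. -/
theorem pair_sum_zero_of_cubes (a b c p : ℝ) (h1 : a + b + c = p) (h3 : a ^ 3 + b ^ 3 + c ^ 3 = p ^ 3) :
    (a + b) * (b + c) * (c + a) = 0 := by
  have : (a + b + c) ^ 3 - (a ^ 3 + b ^ 3 + c ^ 3) = 3 * ((a + b) * (b + c) * (c + a)) := by ring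
  rw [h1, h3] at this
  linarith

/-- `K = 0`, DEGENERATE SUB-CASE 'double F-charge' (`v₁ = v₂ = u₂ = u₃`, `u₁ < v₁ < u₄`): `G₀ = 0`. The gauge form of P2 forces
`A₂ = A₃ = B₁ = B₂`, after which every term of the product formula vanishes. -/
theorem G0_nonneg_K0_double (A₁ A₂ A₃ A₄ B₁ B₂ u₁ u₂ u₃ u₄ v₁ v₂ : ℝ)
    (hA : A₁ + A₂ + A₃ + A₄ = B₁ + B₂) (hC : u₁ + u₂ + u₃ + u₄ = v₁ + v₂)
    (hP1 : (A₁ ^ 2 * u₁ + A₂ ^ 2 * u₂ + A₃ ^ 2 * u₃ + A₄ ^ 2 * u₄) - (B₁ ^ 2 * v₁ + B₂ ^ 2 * v₂) = 0)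
    (hP2 : (A₁ * u₁ ^ 2 + A₂ * u₂ ^ 2 + A₃ * u₃ ^ 2 + A₄ * u₄ ^ 2) - (B₁ * v₁ ^ 2 + B₂ * v₂ ^ 2) = 0)
    (hP4 : (u₁ ^ 3 + u₂ ^ 3 + u₃ ^ 3 + u₄ ^ 3) - (v₁ ^ 3 + v₂ ^ 3) = 0)
    (m₂₁ : |u₂ - v₁| ≤ A₂ - B₁) (m₃₁ : |u₃ - v₁| ≤ A₃ - B₁) (m₂₂ : |u₂ - v₂| ≤ A₂ - B₂) (m₃₂ : |u₃ - v₂| ≤ A₃ - B₂)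
    (h2 : u₂ = v₁) (h3 : u₃ = v₁) (hv : v₂ = v₁) (c₁ : u₁ < v₁) (c₄ : v₁ < u₄) :
    0 ≤ (1 / 2) * ((A₁ ^ 2 + A₂ ^ 2 + A₃ ^ 2 + A₄ ^ 2) - (B₁ ^ 2 + B₂ ^ 2)) * ((u₁ ^ 2 + u₂ ^ 2 + u₃ ^ 2 + u₄ ^ 2) - (v₁ ^ 2 + v₂ ^ 2))
        + ((A₁ * u₁ + A₂ * u₂ + A₃ * u₃ + A₄ * u₄) - (B₁ * v₁ + B₂ * v₂)) ^ 2
        - 3 * ((A₁ ^ 2 * u₁ ^ 2 + A₂ ^ 2 * u₂ ^ 2 + A₃ ^ 2 * u₃ ^ 2 + A₄ ^ 2 * u₄ ^ 2) - (B₁ ^ 2 * v₁ ^ 2 + B₂ ^ 2 * v₂ ^ 2))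
      + (3 * ((u₁ ^ 4 + u₂ ^ 4 + u₃ ^ 4 + u₄ ^ 4) - (v₁ ^ 4 + v₂ ^ 4)) - (3 / 2) * ((u₁ ^ 2 + u₂ ^ 2 + u₃ ^ 2 + u₄ ^ 2) - (v₁ ^ 2 + v₂ ^ 2)) ^ 2) := by
  have hQ2 := Q2_eq_F1 A₁ A₂ A₃ A₄ B₁ B₂ u₁ u₂ u₃ u₄ v₁ v₂ hA hC
  have hQ4 := Q4_eq_F1 u₁ u₂ u₃ u₄ v₁ v₂ hC
  rw [hP1, hP2] at hQ2
  rw [hP4] at hQ4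
  have ha₂ : 0 ≤ A₂ - B₁ := le_trans (abs_nonneg _) m₂₁
  have ha₃ : 0 ≤ A₃ - B₁ := le_trans (abs_nonneg _) m₃₁
  have ha₂' : 0 ≤ A₂ - B₂ := le_trans (abs_nonneg _) m₂₂
  have ha₃' : 0 ≤ A₃ - B₂ := le_trans (abs_nonneg _) m₃₂
  have hg₁ := P2_gauge A₁ A₂ A₃ A₄ B₁ B₂ u₁ u₂ u₃ u₄ v₁ v₂ B₁ hA
  have hg₂ := P2_gauge A₁ A₂ A₃ A₄ B₁ B₂ u₁ u₂ u₃ u₄ v₁ v₂ B₂ hA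
  rw [hP2] at hg₁ hg₂
  subst u₂; subst u₃; subst v₂
  have hu : u₁ = -u₄ := by linarith
  subst u₁
  have hneg : v₁ ^ 2 - u₄ ^ 2 < 0 := by
    have e : v₁ ^ 2 - u₄ ^ 2 = -((u₄ - v₁) * (u₄ + v₁)) := by ring
    rw [e]
    linarith [mul_pos (show 0 < u₄ - v₁ by linarith) (show 0 < u₄ + v₁ by linarith)]
  -- the gauge identity at either level reads (sum of three heights) · (v₁² − u₄²) = 0
  have hA2 : A₂ = B₁ := by
    rcases le_total B₁ B₂ with hB | hB
    · have e : ((A₂ - B₂) + (A₃ - B₂) + (B₂ - B₁)) * (v₁ ^ 2 - u₄ ^ 2) = 0 := by linear_combination -hg₂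
      rcases mul_eq_zero.mp e with h | h
      · linarith
      · exact absurd h (ne_of_lt hneg)
    · have e : ((A₂ - B₁) + (A₃ - B₁) + (B₁ - B₂)) * (v₁ ^ 2 - u₄ ^ 2) = 0 := by linear_combination -hg₁
      rcases mul_eq_zero.mp e with h | h
      · linarith
      · exact absurd h (ne_of_lt hneg)
  subst A₂
  rw [hQ2, hQ4]
  have key : (0:ℝ) ≤ 0 := le_refl 0
  convert key using 1
  ring

/-- `K = 0`, MAIN DEGENERATE SUB-CASE (`u₂ = v₁ < v₂ = u₃`, `u₁ < v₁`, `v₂ < u₄`): `G₀ = 0`. The equality `K₁(F₁) = K₁(F₂)` reads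
`(A₂−B₁)·(neg) = (A₃−B₂)·(pos)`-type, forcing `A₂ = B₁`, after which every term of the product formula from `F₁` vanishes. -/
theorem G0_nonneg_K0_main (A₁ A₂ A₃ A₄ B₁ B₂ u₁ u₂ u₃ u₄ v₁ v₂ : ℝ)
    (hA : A₁ + A₂ + A₃ + A₄ = B₁ + B₂) (hC : u₁ + u₂ + u₃ + u₄ = v₁ + v₂)
    (hP1 : (A₁ ^ 2 * u₁ + A₂ ^ 2 * u₂ + A₃ ^ 2 * u₃ + A₄ ^ 2 * u₄) - (B₁ ^ 2 * v₁ + B₂ ^ 2 * v₂) = 0)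
    (hP2 : (A₁ * u₁ ^ 2 + A₂ * u₂ ^ 2 + A₃ * u₃ ^ 2 + A₄ * u₄ ^ 2) - (B₁ * v₁ ^ 2 + B₂ * v₂ ^ 2) = 0)
    (hP4 : (u₁ ^ 3 + u₂ ^ 3 + u₃ ^ 3 + u₄ ^ 3) - (v₁ ^ 3 + v₂ ^ 3) = 0)
    (m₂₁ : |u₂ - v₁| ≤ A₂ - B₁) (m₃₂ : |u₃ - v₂| ≤ A₃ - B₂)
    (h2 : u₂ = v₁) (h3 : u₃ = v₂) (hv : v₁ < v₂) (c₁ : u₁ < v₁) (c₄ : v₂ < u₄) :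
    0 ≤ (1 / 2) * ((A₁ ^ 2 + A₂ ^ 2 + A₃ ^ 2 + A₄ ^ 2) - (B₁ ^ 2 + B₂ ^ 2)) * ((u₁ ^ 2 + u₂ ^ 2 + u₃ ^ 2 + u₄ ^ 2) - (v₁ ^ 2 + v₂ ^ 2))
        + ((A₁ * u₁ + A₂ * u₂ + A₃ * u₃ + A₄ * u₄) - (B₁ * v₁ + B₂ * v₂)) ^ 2
        - 3 * ((A₁ ^ 2 * u₁ ^ 2 + A₂ ^ 2 * u₂ ^ 2 + A₃ ^ 2 * u₃ ^ 2 + A₄ ^ 2 * u₄ ^ 2) - (B₁ ^ 2 * v₁ ^ 2 + B₂ ^ 2 * v₂ ^ 2))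
      + (3 * ((u₁ ^ 4 + u₂ ^ 4 + u₃ ^ 4 + u₄ ^ 4) - (v₁ ^ 4 + v₂ ^ 4)) - (3 / 2) * ((u₁ ^ 2 + u₂ ^ 2 + u₃ ^ 2 + u₄ ^ 2) - (v₁ ^ 2 + v₂ ^ 2)) ^ 2) := by
  have hQ2 := Q2_eq_F1 A₁ A₂ A₃ A₄ B₁ B₂ u₁ u₂ u₃ u₄ v₁ v₂ hA hC
  have hQ4 := Q4_eq_F1 u₁ u₂ u₃ u₄ v₁ v₂ hC
  have hK1 := K1_F1_sub_K1_F2 A₁ A₂ A₃ A₄ B₁ B₂ u₁ u₂ u₃ u₄ v₁ v₂ hA hC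
  rw [hP1, hP2] at hQ2
  rw [hP4] at hQ4
  rw [hP2, hP4] at hK1
  have ha₂ : 0 ≤ A₂ - B₁ := le_trans (abs_nonneg _) m₂₁
  have ha₃' : 0 ≤ A₃ - B₂ := le_trans (abs_nonneg _) m₃₂
  subst u₂; subst u₃
  have e : (A₂ - B₁) * ((v₁ - u₁) * (v₂ - v₁) * (u₄ - v₁)) = -((A₃ - B₂) * ((v₂ - u₁) * (v₂ - v₁) * (u₄ - v₂))) := by
    linear_combination -hK1
  have hpos : 0 < (v₁ - u₁) * (v₂ - v₁) * (u₄ - v₁) := by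
    have : 0 < (v₁ - u₁) * (v₂ - v₁) := mul_pos (by linarith) (by linarith)
    exact mul_pos this (by linarith)
  have hpos' : 0 ≤ (A₃ - B₂) * ((v₂ - u₁) * (v₂ - v₁) * (u₄ - v₂)) := by
    have : 0 < (v₂ - u₁) * (v₂ - v₁) := mul_pos (by linarith) (by linarith)
    exact mul_nonneg ha₃' (mul_pos this (by linarith)).le
  have hzero : (A₂ - B₁) * ((v₁ - u₁) * (v₂ - v₁) * (u₄ - v₁)) = 0 :=
    le_antisymm (by linarith) (mul_nonneg ha₂ hpos.le)
  have hA2 : A₂ = B₁ := by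
    rcases mul_eq_zero.mp hzero with h | h
    · linarith
    · exact absurd h (ne_of_gt hpos)
  subst A₂
  rw [hQ2, hQ4]
  have key : (0:ℝ) ≤ 0 := le_refl 0
  convert key using 1
  ring

/-- `K = 0`, IMPOSSIBLE SUB-CASE A: `v₁ = v₂ = u₂ < u₃` with `u₁ < v₁`, `v₂ < u₄` contradicts centring + P4 (a pair of the remaining
charges would have to sum to zero). -/
theorem K0_impossible_a (u₁ u₂ u₃ u₄ v₁ v₂ : ℝ) (hC : u₁ + u₂ + u₃ + u₄ = v₁ + v₂)
    (hP4 : (u₁ ^ 3 + u₂ ^ 3 + u₃ ^ 3 + u₄ ^ 3) - (v₁ ^ 3 + v₂ ^ 3) = 0)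
    (hv : v₂ = v₁) (h2 : u₂ = v₁) (h3 : v₁ < u₃) (c₁ : u₁ < v₁) (c₄ : v₁ < u₄) : False := by
  subst v₂; subst u₂
  have e := pair_sum_zero_of_cubes u₁ u₃ u₄ v₁ (by linarith) (by linarith)
  rcases mul_eq_zero.mp e with e | e
  · rcases mul_eq_zero.mp e with e | e
    · linarith
    · linarith
  · linarith

/-- `K = 0`, IMPOSSIBLE SUB-CASE B: `u₂ < v₁ = v₂ = u₃` with `u₁ < v₁`, `v₂ < u₄`. -/
theorem K0_impossible_b (u₁ u₂ u₃ u₄ v₁ v₂ : ℝ) (hC : u₁ + u₂ + u₃ + u₄ = v₁ + v₂)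
    (hP4 : (u₁ ^ 3 + u₂ ^ 3 + u₃ ^ 3 + u₄ ^ 3) - (v₁ ^ 3 + v₂ ^ 3) = 0)
    (hv : v₂ = v₁) (h3 : u₃ = v₁) (h2 : u₂ < v₁) (c₁ : u₁ < v₁) (c₄ : v₁ < u₄) : False := by
  subst v₂; subst u₃
  have e := pair_sum_zero_of_cubes u₁ u₂ u₄ v₁ (by linarith) (by linarith)
  rcases mul_eq_zero.mp e with e | e
  · rcases mul_eq_zero.mp e with e | e
    · linarith
    · linarith
  · linarith

/-- From a vanishing product of four factors whose first and last factors are non-zero, one of the middle two vanishes. -/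
theorem middle_zero_of_prod4 (b₁ b₂ b₃ b₄ : ℝ) (h : b₁ * b₂ * b₃ * b₄ = 0) (h₁ : b₁ ≠ 0) (h₄ : b₄ ≠ 0) : b₂ = 0 ∨ b₃ = 0 := by
  rcases mul_eq_zero.mp h with h | h
  · rcases mul_eq_zero.mp h with h | h
    · rcases mul_eq_zero.mp h with h | h
      · exact absurd h h₁
      · exact Or.inl h
    · exact Or.inr h
  · exact absurd h h₄

/-- `K = 0` (sorted E-charges, `v₁ ≤ v₂`, `u₁ < v₁`, `v₂ < u₄`): `G₀ ≥ 0` — assembling the degenerate sub-cases. -/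
theorem G0_nonneg_K0 (A₁ A₂ A₃ A₄ B₁ B₂ u₁ u₂ u₃ u₄ v₁ v₂ : ℝ)
    (hA : A₁ + A₂ + A₃ + A₄ = B₁ + B₂) (hC : u₁ + u₂ + u₃ + u₄ = v₁ + v₂)
    (hP1 : (A₁ ^ 2 * u₁ + A₂ ^ 2 * u₂ + A₃ ^ 2 * u₃ + A₄ ^ 2 * u₄) - (B₁ ^ 2 * v₁ + B₂ ^ 2 * v₂) = 0)
    (hP2 : (A₁ * u₁ ^ 2 + A₂ * u₂ ^ 2 + A₃ * u₃ ^ 2 + A₄ * u₄ ^ 2) - (B₁ * v₁ ^ 2 + B₂ * v₂ ^ 2) = 0)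
    (hP4 : (u₁ ^ 3 + u₂ ^ 3 + u₃ ^ 3 + u₄ ^ 3) - (v₁ ^ 3 + v₂ ^ 3) = 0)
    (m₂₁ : |u₂ - v₁| ≤ A₂ - B₁) (m₃₁ : |u₃ - v₁| ≤ A₃ - B₁) (m₂₂ : |u₂ - v₂| ≤ A₂ - B₂) (m₃₂ : |u₃ - v₂| ≤ A₃ - B₂)
    (o₂₃ : u₂ ≤ u₃) (ov : v₁ ≤ v₂) (c₁ : u₁ < v₁) (c₄ : v₂ < u₄)
    (hK : (u₁ - v₁) * (u₂ - v₁) * (u₃ - v₁) * (u₄ - v₁) = 0) :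
    0 ≤ (1 / 2) * ((A₁ ^ 2 + A₂ ^ 2 + A₃ ^ 2 + A₄ ^ 2) - (B₁ ^ 2 + B₂ ^ 2)) * ((u₁ ^ 2 + u₂ ^ 2 + u₃ ^ 2 + u₄ ^ 2) - (v₁ ^ 2 + v₂ ^ 2))
        + ((A₁ * u₁ + A₂ * u₂ + A₃ * u₃ + A₄ * u₄) - (B₁ * v₁ + B₂ * v₂)) ^ 2
        - 3 * ((A₁ ^ 2 * u₁ ^ 2 + A₂ ^ 2 * u₂ ^ 2 + A₃ ^ 2 * u₃ ^ 2 + A₄ ^ 2 * u₄ ^ 2) - (B₁ ^ 2 * v₁ ^ 2 + B₂ ^ 2 * v₂ ^ 2))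
      + (3 * ((u₁ ^ 4 + u₂ ^ 4 + u₃ ^ 4 + u₄ ^ 4) - (v₁ ^ 4 + v₂ ^ 4)) - (3 / 2) * ((u₁ ^ 2 + u₂ ^ 2 + u₃ ^ 2 + u₄ ^ 2) - (v₁ ^ 2 + v₂ ^ 2)) ^ 2) := by
  have hK' : (u₁ - v₂) * (u₂ - v₂) * (u₃ - v₂) * (u₄ - v₂) = 0 := by
    have h := K0_F1_sub_K0_F2 u₁ u₂ u₃ u₄ v₁ v₂ hC
    rw [hP4] at h
    linarith
  have m1 := middle_zero_of_prod4 _ _ _ _ hK (by linarith) (by linarith)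
  have m2 := middle_zero_of_prod4 _ _ _ _ hK' (by linarith) (by linarith)
  rcases m1 with e2 | e3
  · -- u₂ = v₁
    rcases m2 with f2 | f3
    · -- u₂ = v₂ as well: v₁ = v₂ = u₂; then u₃ = v₁ (double) or u₃ > v₁ (impossible)
      rcases eq_or_lt_of_le (show u₂ ≤ u₃ from o₂₃) with g | g
      · exact G0_nonneg_K0_double A₁ A₂ A₃ A₄ B₁ B₂ u₁ u₂ u₃ u₄ v₁ v₂ hA hC hP1 hP2 hP4 m₂₁ m₃₁ m₂₂ m₃₂
          (by linarith) (by linarith) (by linarith) c₁ (by linarith)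
      · exact (K0_impossible_a u₁ u₂ u₃ u₄ v₁ v₂ hC hP4 (by linarith) (by linarith) (by linarith) c₁ (by linarith)).elim
    · -- u₃ = v₂: main case if v₁ < v₂, double case if v₁ = v₂
      rcases eq_or_lt_of_le ov with g | g
      · exact G0_nonneg_K0_double A₁ A₂ A₃ A₄ B₁ B₂ u₁ u₂ u₃ u₄ v₁ v₂ hA hC hP1 hP2 hP4 m₂₁ m₃₁ m₂₂ m₃₂
          (by linarith) (by linarith) (by linarith) c₁ (by linarith)
      · exact G0_nonneg_K0_main A₁ A₂ A₃ A₄ B₁ B₂ u₁ u₂ u₃ u₄ v₁ v₂ hA hC hP1 hP2 hP4 m₂₁ m₃₂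
          (by linarith) (by linarith) g c₁ c₄
  · -- u₃ = v₁ (so u₂ ≤ v₁)
    rcases m2 with f2 | f3
    · -- u₂ = v₂ ≥ v₁ ≥ u₂: all equal → double
      exact G0_nonneg_K0_double A₁ A₂ A₃ A₄ B₁ B₂ u₁ u₂ u₃ u₄ v₁ v₂ hA hC hP1 hP2 hP4 m₂₁ m₃₁ m₂₂ m₃₂
        (by linarith) (by linarith) (by linarith) c₁ (by linarith)
    · -- u₃ = v₂ = v₁; u₂ = v₁ (double) or u₂ < v₁ (impossible)
      rcases eq_or_lt_of_le (show u₂ ≤ u₃ from o₂₃) with g | g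
      · exact G0_nonneg_K0_double A₁ A₂ A₃ A₄ B₁ B₂ u₁ u₂ u₃ u₄ v₁ v₂ hA hC hP1 hP2 hP4 m₂₁ m₃₁ m₂₂ m₃₂
          (by linarith) (by linarith) (by linarith) c₁ (by linarith)
      · exact (K0_impossible_b u₁ u₂ u₃ u₄ v₁ v₂ hC hP4 (by linarith) (by linarith) (by linarith) c₁ (by linarith)).elim

/-- **CONJECTURE N IN FORMAT (4,2), sorted form.** For real `(4,2)` configurations that are centred, pure (P1, P2, P4) and pairwise ample,
with the E-charges sorted `u₁ ≤ u₂ ≤ u₃ ≤ u₄` and `v₁ ≤ v₂` (no loss of generality: the hypotheses and the conclusion are invariant under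
relabelling the E-roots and swapping the F-roots), `G₀ = Q₂ + Q₄ ≥ 0`. -/
theorem conjectureN_42_sorted (A₁ A₂ A₃ A₄ B₁ B₂ u₁ u₂ u₃ u₄ v₁ v₂ : ℝ)
    (hA : A₁ + A₂ + A₃ + A₄ = B₁ + B₂) (hC : u₁ + u₂ + u₃ + u₄ = v₁ + v₂)
    (hP1 : (A₁ ^ 2 * u₁ + A₂ ^ 2 * u₂ + A₃ ^ 2 * u₃ + A₄ ^ 2 * u₄) - (B₁ ^ 2 * v₁ + B₂ ^ 2 * v₂) = 0)
    (hP2 : (A₁ * u₁ ^ 2 + A₂ * u₂ ^ 2 + A₃ * u₃ ^ 2 + A₄ * u₄ ^ 2) - (B₁ * v₁ ^ 2 + B₂ * v₂ ^ 2) = 0)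
    (hP4 : (u₁ ^ 3 + u₂ ^ 3 + u₃ ^ 3 + u₄ ^ 3) - (v₁ ^ 3 + v₂ ^ 3) = 0)
    (m₁₁ : |u₁ - v₁| ≤ A₁ - B₁) (m₂₁ : |u₂ - v₁| ≤ A₂ - B₁) (m₃₁ : |u₃ - v₁| ≤ A₃ - B₁) (m₄₁ : |u₄ - v₁| ≤ A₄ - B₁)
    (m₁₂ : |u₁ - v₂| ≤ A₁ - B₂) (m₂₂ : |u₂ - v₂| ≤ A₂ - B₂) (m₃₂ : |u₃ - v₂| ≤ A₃ - B₂) (m₄₂ : |u₄ - v₂| ≤ A₄ - B₂)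
    (o₁₂ : u₁ ≤ u₂) (o₂₃ : u₂ ≤ u₃) (o₃₄ : u₃ ≤ u₄) (ov : v₁ ≤ v₂) :
    0 ≤ (1 / 2) * ((A₁ ^ 2 + A₂ ^ 2 + A₃ ^ 2 + A₄ ^ 2) - (B₁ ^ 2 + B₂ ^ 2)) * ((u₁ ^ 2 + u₂ ^ 2 + u₃ ^ 2 + u₄ ^ 2) - (v₁ ^ 2 + v₂ ^ 2))
        + ((A₁ * u₁ + A₂ * u₂ + A₃ * u₃ + A₄ * u₄) - (B₁ * v₁ + B₂ * v₂)) ^ 2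
        - 3 * ((A₁ ^ 2 * u₁ ^ 2 + A₂ ^ 2 * u₂ ^ 2 + A₃ ^ 2 * u₃ ^ 2 + A₄ ^ 2 * u₄ ^ 2) - (B₁ ^ 2 * v₁ ^ 2 + B₂ ^ 2 * v₂ ^ 2))
      + (3 * ((u₁ ^ 4 + u₂ ^ 4 + u₃ ^ 4 + u₄ ^ 4) - (v₁ ^ 4 + v₂ ^ 4)) - (3 / 2) * ((u₁ ^ 2 + u₂ ^ 2 + u₃ ^ 2 + u₄ ^ 2) - (v₁ ^ 2 + v₂ ^ 2)) ^ 2) := by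
  by_cases hlo : v₁ ≤ u₁
  · exact G0_nonneg_of_F1_below A₁ A₂ A₃ A₄ B₁ B₂ u₁ u₂ u₃ u₄ v₁ v₂ hA hC hP1 hP2 hP4 m₁₁ m₂₁ m₃₁ m₄₁ hlo (by linarith) (by linarith) (by linarith)
  by_cases hhi : u₄ ≤ v₂
  · exact G0_nonneg_of_F2_above A₁ A₂ A₃ A₄ B₁ B₂ u₁ u₂ u₃ u₄ v₁ v₂ hA hC hP1 hP2 hP4 m₁₂ m₂₂ m₃₂ m₄₂ (by linarith) (by linarith) (by linarith) hhi
  push Not at hlo hhi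
  rcases lt_trichotomy ((u₁ - v₁) * (u₂ - v₁) * (u₃ - v₁) * (u₄ - v₁)) 0 with hK | hK | hK
  · -- K < 0: the two middle E-charges are on the same side of v₁ (and of v₂)
    have hb4 : 0 < u₄ - v₁ := by linarith
    have h123 : (u₁ - v₁) * (u₂ - v₁) * (u₃ - v₁) < 0 := by
      by_contra h
      push Not at h
      have := mul_nonneg h hb4.le
      linarith
    have h23 : 0 < (u₂ - v₁) * (u₃ - v₁) := by
      by_contra h
      push Not at h
      have e : (u₁ - v₁) * (u₂ - v₁) * (u₃ - v₁) = (u₁ - v₁) * ((u₂ - v₁) * (u₃ - v₁)) := by ring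
      have := mul_nonneg_of_nonpos_of_nonpos (by linarith : u₁ - v₁ ≤ 0) h
      linarith
    rcases lt_or_ge v₁ u₂ with h2 | h2
    · -- v₁ < u₂ ≤ u₃: look at v₂
      have hK' : (u₁ - v₂) * (u₂ - v₂) * (u₃ - v₂) * (u₄ - v₂) < 0 := by
        have h := K0_F1_sub_K0_F2 u₁ u₂ u₃ u₄ v₁ v₂ hC
        rw [hP4] at h
        linarith
      have hb4' : 0 < u₄ - v₂ := by linarith
      have h123' : (u₁ - v₂) * (u₂ - v₂) * (u₃ - v₂) < 0 := by
        by_contra h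
        push Not at h
        have := mul_nonneg h hb4'.le
        linarith
      have h23' : 0 < (u₂ - v₂) * (u₃ - v₂) := by
        by_contra h
        push Not at h
        have e : (u₁ - v₂) * (u₂ - v₂) * (u₃ - v₂) = (u₁ - v₂) * ((u₂ - v₂) * (u₃ - v₂)) := by ring
        have := mul_nonneg_of_nonpos_of_nonpos (by linarith : u₁ - v₂ ≤ 0) h
        linarith
      rcases lt_or_ge u₃ v₂ with h3 | h3
      · -- pattern E F E E F E
        exact G0_nonneg_pattern_EFEEFE A₁ A₂ A₃ A₄ B₁ B₂ u₁ u₂ u₃ u₄ v₁ v₂ hA hC hP1 hP2 hP4 m₁₁ m₂₁ m₃₁ m₄₁ m₁₂ m₂₂ m₃₂ m₄₂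
          hlo h2 (by linarith) (by linarith) h3 hhi
      · -- v₂ ≤ u₃, hence v₂ < u₂ too (same side): pattern E F F E E E — impossible
        have hu3 : v₂ < u₃ := by
          rcases eq_or_lt_of_le h3 with g | g
          · exfalso; rw [g, sub_self, mul_zero] at h23'; exact lt_irrefl _ h23'
          · exact g
        have hu2 : v₂ < u₂ := by
          by_contra h
          push Not at h
          have := mul_nonpos_of_nonpos_of_nonneg (by linarith : u₂ - v₂ ≤ 0) (by linarith : 0 ≤ u₃ - v₂)
          linarith
        exact (no_config_K_neg_none_between A₁ A₂ A₃ A₄ B₁ B₂ u₁ u₂ u₃ u₄ v₁ v₂ hA hC hP2 hP4 m₁₁ m₂₁ m₃₁ m₄₁ m₁₂ m₂₂ m₃₂ m₄₂ hK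
          (mul_pos_of_neg_of_neg (by linarith) (by linarith)) (mul_pos (by linarith) (by linarith))
          (mul_pos (by linarith) (by linarith)) (mul_pos (by linarith) (by linarith))).elim
    · -- u₂ ≤ v₁: then u₃ < v₁ as well: pattern E E E F F E — impossible
      have hu2 : u₂ < v₁ := by
        rcases eq_or_lt_of_le h2 with g | g
        · exfalso; rw [← g, sub_self, zero_mul] at h23; exact lt_irrefl _ h23
        · exact g
      have hu3 : u₃ < v₁ := by
        by_contra h
        push Not at h
        have := mul_nonpos_of_nonpos_of_nonneg (by linarith : u₂ - v₁ ≤ 0) (by linarith : 0 ≤ u₃ - v₁)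
        linarith
      exact (no_config_K_neg_none_between A₁ A₂ A₃ A₄ B₁ B₂ u₁ u₂ u₃ u₄ v₁ v₂ hA hC hP2 hP4 m₁₁ m₂₁ m₃₁ m₄₁ m₁₂ m₂₂ m₃₂ m₄₂ hK
        (mul_pos_of_neg_of_neg (by linarith) (by linarith)) (mul_pos_of_neg_of_neg (by linarith) (by linarith))
        (mul_pos_of_neg_of_neg (by linarith) (by linarith)) (mul_pos (by linarith) (by linarith))).elim
  · -- K = 0
    exact G0_nonneg_K0 A₁ A₂ A₃ A₄ B₁ B₂ u₁ u₂ u₃ u₄ v₁ v₂ hA hC hP1 hP2 hP4 m₂₁ m₃₁ m₂₂ m₃₂ o₂₃ ov hlo hhi hK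
  · -- K > 0: impossible
    exact (no_config_K_pos_split A₁ A₂ A₃ A₄ B₁ B₂ u₁ u₂ u₃ u₄ v₁ v₂ hA hC hP2 hP4 m₁₁ m₂₁ m₃₁ m₄₁ m₁₂ m₂₂ m₃₂ m₄₂
      o₁₂ (by linarith) (by linarith) o₃₄ ov hlo hhi hK).elim

end Summit.HodgeConjecture.HodgeConjecture.WeilClassTestFormatFourTwo
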